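import Summits.ValiantsHypothesis.ValiantsHypothesis.Theses.BorderApolarity
import Summits.ValiantsHypothesis.ValiantsHypothesis.Theorems.BorderApolarityToricFixedPointsToricLimitIsInitialAux1

/-!
# `ToricFixedPoints` / line `form_then_lift`, stub F1 (`stub_formDebordering`) — the End-type case
is a kernel fact: every linear image `A·f` of a form `f` is a toric-limit form of `f`

F1 asks that every `H₀(n,m)`-semi-invariant border form `F` of `det_m` be of the toric shape
`F = a • u·(top w-component of g·det_m)` (`u, g ∈ GL`, `w ∈ ℕ^{m×m}`).  The line card records that
"over End-type top forms it is trivial"; this file makes that literal and unconditional: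

* `linSubst_diagonal01_eq_weightedHomogeneousComponent` — for a degree-`m` form `f`, killing the
  coordinates outside a set `S` (the substitution `diag(𝟙_S)`) returns exactly the top
  `𝟙_S`-weighted component `weightedHomogeneousComponent 𝟙_S m f`;
* `exists_toricShape_linSubst` — for EVERY square matrix `A` (invertible or not) and every
  degree-`m` form `f` over a field: `A·f = u·(weightedHomogeneousComponent w m (g·f))` with
  `u, g ∈ GL`, `w = 𝟙_S ∈ {0,1}^σ` and all `w`-weights of `g·f` at most `m` — rank normal form
  `A = P·diag(D)·Q` (transvections, `Matrix.Pivot`), `diag D = diag D'·diag 𝟙_{D ≠ 0}` with `D'`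
  invertible, `g = Q`, `u = P·diag D'`;
* `formDebordering_endType` — the conclusion of `stub_formDebordering` for every End-type form
  `F = A·det_m` (with `a = 1`, `e = m`), no limit / semi-invariance hypothesis needed.

So F1's content is exactly the NON-End border forms (`bdc_pad < dc`, Disproof.lean §6b–c); for the
fibres listed in the line file as End-type ((3,3) cones, (3,4) `ℓ⁴`/`ℓ·det₃Y`, (3,5) `ℓ²det₃Y`,
(3,7) `ℓ⁴per₃`) F1 now holds in the kernel.  Refuter/theory seat `val-width-5779-d1`
(stmt-ValiantsHypothesis-5779).  Honest framing: elementary linear algebra; VP ≠ VNP is not touched.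
-/

open MvPolynomial Finset
open Literature.Computability.AlgebraicComplexity
open Summit.ValiantsHypothesis.ValiantsHypothesis.Theorems.BorderApolarityToricFixedPoints
  (tli_coeff_linSubst_diagonal)

namespace Summit.ValiantsHypothesis.Cruxes.ToricFixedPoints.Negative

variable {σ : Type*} [Fintype σ] [DecidableEq σ] {K : Type*} [Field K]

/-- **Coordinate projections are top weighted components.**  For a degree-`m` form `f` and a
`{0,1}`-pattern (`c i = 0, w i = 0` or `c i = 1, w i = 1` for each `i`): the diagonal substitution
`diag(c)` (kill the coordinates with `c i = 0`) equals `weightedHomogeneousComponent w m`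
(the monomials all of whose variables have weight `1`). [folklore] -/
theorem linSubst_diagonal01_eq_weightedHomogeneousComponent (c : σ → K) (w : σ → ℕ)
    (h01 : ∀ i, (c i = 0 ∧ w i = 0) ∨ (c i = 1 ∧ w i = 1)) {f : MvPolynomial σ K} {m : ℕ}
    (hf : f.IsHomogeneous m) :
    linSubst σ K (Matrix.diagonal c) f = weightedHomogeneousComponent w m f := by
  classical
  ext d
  rw [tli_coeff_linSubst_diagonal, coeff_weightedHomogeneousComponent]
  by_cases hd : coeff d f = 0
  · rw [hd, mul_zero, ite_self]
  have hdeg : ∑ i ∈ d.support, d i = m := by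
    have h := hf hd
    rw [Finsupp.weight_apply, Finsupp.sum] at h
    simpa using h
  have hw : Finsupp.weight w d = ∑ i ∈ d.support, d i * w i := by
    rw [Finsupp.weight_apply, Finsupp.sum]
    rfl
  by_cases hs : ∀ i ∈ d.support, c i = 1
  · have hw1 : ∀ i ∈ d.support, w i = 1 := fun i hi => by
      rcases h01 i with h | h
      · exact absurd (hs i hi) (by rw [h.1]; exact zero_ne_one)
      · exact h.2
    have hp : ∏ i ∈ d.support, c i ^ d i = 1 :=
      Finset.prod_eq_one fun i hi => by rw [hs i hi, one_pow]
    have hwm : Finsupp.weight w d = m := by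
      rw [hw, ← hdeg]
      exact Finset.sum_congr rfl fun i hi => by rw [hw1 i hi, mul_one]
    rw [hp, one_mul, if_pos hwm]
  · push Not at hs
    obtain ⟨i, hi, hci⟩ := hs
    have hc0 : c i = 0 ∧ w i = 0 := by
      rcases h01 i with h | h
      · exact h
      · exact absurd h.1 hci
    have hp : ∏ j ∈ d.support, c j ^ d j = 0 :=
      Finset.prod_eq_zero hi (by rw [hc0.1, zero_pow (Finsupp.mem_support_iff.1 hi)])
    have hwm : Finsupp.weight w d ≠ m := by
      rw [hw, ← hdeg]
      refine ne_of_lt (Finset.sum_lt_sum (fun j _ => ?_) ⟨i, hi, ?_⟩)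
      · rcases h01 j with h | h
        · rw [h.2, mul_zero]; exact Nat.zero_le _
        · rw [h.2, mul_one]
      · rw [hc0.2, mul_zero]
        exact Nat.pos_of_ne_zero (Finsupp.mem_support_iff.1 hi)
    rw [hp, zero_mul, if_neg hwm]

/-- **Every linear image of a form is a toric-limit form of it.**  For any square matrix `A` and
any degree-`m` form `f` over a field there are `u, g ∈ GL` and weights `w ∈ {0,1}^σ` with all
`w`-weights of `g·f` at most `m` and `A·f = u·(weightedHomogeneousComponent w m (g·f))`: write
`A = P·diag(D)·Q` with `P, Q` products of transvections, split `diag D = diag D'·diag 𝟙_{D ≠ 0}` with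
`D'` invertible, and take `g = Q`, `u = P·diag D'`, `w = 𝟙_{D ≠ 0}`. [folklore] -/
theorem exists_toricShape_linSubst (A : Matrix σ σ K) {f : MvPolynomial σ K} {m : ℕ}
    (hf : f.IsHomogeneous m) :
    ∃ (u g : Matrix.GeneralLinearGroup σ K) (w : σ → ℕ),
      (∀ d ∈ (linSubst σ K (g : Matrix σ σ K) f).support, Finsupp.weight w d ≤ m) ∧
      linSubst σ K A f = linSubst σ K (u : Matrix σ σ K)
        (weightedHomogeneousComponent w m (linSubst σ K (g : Matrix σ σ K) f)) := by
  classical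
  obtain ⟨L, L', D, hA⟩ := Matrix.Pivot.exists_list_transvec_mul_diagonal_mul_list_transvec A
  set P := (L.map Matrix.TransvectionStruct.toMatrix).prod with hP
  set Q := (L'.map Matrix.TransvectionStruct.toMatrix).prod with hQ
  let D' : σ → K := fun i => if D i = 0 then 1 else D i
  let c : σ → K := fun i => if D i = 0 then 0 else 1
  let w : σ → ℕ := fun i => if D i = 0 then 0 else 1
  have h01 : ∀ i, (c i = 0 ∧ w i = 0) ∨ (c i = 1 ∧ w i = 1) := fun i => by
    by_cases h : D i = 0
    · exact Or.inl ⟨if_pos h, if_pos h⟩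
    · exact Or.inr ⟨if_neg h, if_neg h⟩
  have hD : Matrix.diagonal D = Matrix.diagonal D' * Matrix.diagonal c := by
    rw [Matrix.diagonal_mul_diagonal]
    congr 1
    funext i
    by_cases h : D i = 0 <;> simp [D', c, h]
  have hPdet : P.det = 1 := Matrix.TransvectionStruct.det_toMatrix_prod L
  have hQdet : Q.det = 1 := Matrix.TransvectionStruct.det_toMatrix_prod L'
  have hD'det : (Matrix.diagonal D').det ≠ 0 := by
    rw [Matrix.det_diagonal]
    exact Finset.prod_ne_zero_iff.2 fun i _ => by by_cases h : D i = 0 <;> simp [D', h]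
  have hudet : (P * Matrix.diagonal D').det ≠ 0 := by
    rw [Matrix.det_mul, hPdet, one_mul]; exact hD'det
  refine ⟨Matrix.GeneralLinearGroup.mkOfDetNeZero _ hudet,
    Matrix.GeneralLinearGroup.mkOfDetNeZero Q (by rw [hQdet]; exact one_ne_zero), w, ?_, ?_⟩
  · intro d hd
    have hfQ : (linSubst σ K Q f).IsHomogeneous m := linSubst_isHomogeneous Q hf
    have hdeg : ∑ i ∈ d.support, d i = m := by
      have h := hfQ (mem_support_iff.1 hd)
      rw [Finsupp.weight_apply, Finsupp.sum] at h
      simpa using h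
    have hw : Finsupp.weight w d = ∑ i ∈ d.support, d i * w i := by
      rw [Finsupp.weight_apply, Finsupp.sum]
      rfl
    show Finsupp.weight w d ≤ m
    rw [hw, ← hdeg]
    refine Finset.sum_le_sum fun j _ => ?_
    rcases h01 j with h | h
    · rw [h.2, mul_zero]; exact Nat.zero_le _
    · rw [h.2, mul_one]
  · show linSubst σ K A f = linSubst σ K (P * Matrix.diagonal D')
      (weightedHomogeneousComponent w m (linSubst σ K Q f))
    rw [hA, hD, ← linSubst_diagonal01_eq_weightedHomogeneousComponent c w h01
      (linSubst_isHomogeneous Q hf)]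
    simp only [linSubst_mul, AlgHom.comp_apply, Matrix.mul_assoc]

/-- **F1 (`stub_formDebordering`) holds for every End-type form**, unconditionally: for any
`m × m`-variable substitution matrix `A`, the form `F = A·det_m` has the toric shape
`F = a • u·(weightedHomogeneousComponent w e (g·det_m))` with `a = 1 ≠ 0`, `e = m` and all
`w`-weights of `g·det_m` at most `e` — literally the conclusion of
`Cruxes/ToricFixedPoints/Lines/form_then_lift.lean :: stub_formDebordering`. [folklore] -/
theorem formDebordering_endType (m : ℕ) (A : Matrix (Fin m × Fin m) (Fin m × Fin m) ℂ) :
    ∃ (u g : Matrix.GeneralLinearGroup (Fin m × Fin m) ℂ) (w : Fin m × Fin m → ℕ) (e : ℕ) (a : ℂ),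
      a ≠ 0 ∧
      (∀ d ∈ (linSubst (Fin m × Fin m) ℂ (g : Matrix (Fin m × Fin m) (Fin m × Fin m) ℂ)
          (detPoly (Fin m) ℂ)).support, Finsupp.weight w d ≤ e) ∧
      linSubst (Fin m × Fin m) ℂ A (detPoly (Fin m) ℂ) =
        a • linSubst (Fin m × Fin m) ℂ (u : Matrix (Fin m × Fin m) (Fin m × Fin m) ℂ)
          (MvPolynomial.weightedHomogeneousComponent w e
            (linSubst (Fin m × Fin m) ℂ (g : Matrix (Fin m × Fin m) (Fin m × Fin m) ℂ)
              (detPoly (Fin m) ℂ))) := by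
  have hdet : (detPoly (Fin m) ℂ).IsHomogeneous m := by
    simpa [Fintype.card_fin] using detPoly_isHomogeneous (n := Fin m) (k := ℂ)
  obtain ⟨u, g, w, hw, hEq⟩ := exists_toricShape_linSubst A hdet
  exact ⟨u, g, w, m, 1, one_ne_zero, hw, by rw [one_smul]; exact hEq⟩

/-- The same for a form given as a member of the endomorphism orbit `End·det_m`
(`Literature…LinSubst.endOrbit`). [folklore] -/
theorem formDebordering_of_mem_endOrbit (m : ℕ) {F : MvPolynomial (Fin m × Fin m) ℂ}
    (hF : F ∈ endOrbit (Fin m × Fin m) ℂ (detPoly (Fin m) ℂ)) :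
    ∃ (u g : Matrix.GeneralLinearGroup (Fin m × Fin m) ℂ) (w : Fin m × Fin m → ℕ) (e : ℕ) (a : ℂ),
      a ≠ 0 ∧
      (∀ d ∈ (linSubst (Fin m × Fin m) ℂ (g : Matrix (Fin m × Fin m) (Fin m × Fin m) ℂ)
          (detPoly (Fin m) ℂ)).support, Finsupp.weight w d ≤ e) ∧
      F = a • linSubst (Fin m × Fin m) ℂ (u : Matrix (Fin m × Fin m) (Fin m × Fin m) ℂ)
          (MvPolynomial.weightedHomogeneousComponent w e
            (linSubst (Fin m × Fin m) ℂ (g : Matrix (Fin m × Fin m) (Fin m × Fin m) ℂ)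
              (detPoly (Fin m) ℂ))) := by
  obtain ⟨A, rfl⟩ := hF
  exact formDebordering_endType m A

end Summit.ValiantsHypothesis.Cruxes.ToricFixedPoints.Negative
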